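import Literature.NumberTheory.Automorphic.IrreducibleClassesBoxChar                    -- ★ `SmoothIrrep.boxChar`, `IrrClass.boxChar`, `boxChar_mk`
import Literature.NumberTheory.Automorphic.HeckeEigencharacterPackage                  -- ★ `IrrClass.IsAdmissible`, `isAdmissible_mk`
import Literature.NumberTheory.Automorphic.RestrictedTensorProductIrreducibleProofs    -- ★ Schur `Representation.IsAdmissible.exists_eq_smul_id`
import HarnessLib

/-!
# R90-TF · S4 (Ch. 13.1–2) · hand p04 — F1 «SCHUR ⊠-SPLITTING»: an ADMISSIBLE irreducible class of `G × G₁`, `G₁` commutative,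
# is `σ ⊠ χ` with `σ` admissible and `χ` a smooth character of `G₁` (the converse of ★ `IrrClass.boxChar`)

Cell `hodgecm-mathlib`, crux H413 (`stmt-HodgeConjecture-24833`), route of record `HCCMUnconditional`; programme R90-TF (brief
`director/R90-BRIEF.v2.md` 1f40d54518340a35), section S4 = Rogawski Ch. 13.1–2 (base `R90-C131`), seat R90-C131-p04 (g0), socket S4#B3
`R90.S4.stub_R90_S4_H_cover` (`Cruxes/H413/Lines/R90_S4_HPacketsU2B.lean` :338) ROAD «SCHUR ⊠-SPLITTING + FINITE ORBIT» (DEAL-S4-WAVE1, K2E2-plan (g6)),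
step (F1).  Lane `--supports stmt-HodgeConjecture-24833 --as helper`; ONE public theorem, no definition, no instance, no notation, no `sorry`.

THE MATHEMATICS ([BushnellHenniart2006, §2.6 Cor. 1 (Schur), §9.1]; [Rogawski1990, §12.1 p. 172 «`ρ = ρ₁ ⊗ χ`, where `ρ₁` is a representation of
`U(2)` and `χ` is a character of `U(1)`»]).  Let `τ` be an irreducible ADMISSIBLE smooth representation of `G × G₁` on `V`, with `G₁` commutative and
`G`, `G₁` each possessing a compact open subgroup.  Every `(1, g₁)` is central, so `τ(1, g₁)` is a `G × G₁`-endomorphism of `V`, hence a SCALAR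
`χ(g₁)` by Schur's lemma for admissible irreducibles (★ `Representation.IsAdmissible.exists_eq_smul_id`: eigenvalue on a finite-dimensional `V^K`);
`χ : G₁ →* ℂˣ` is a character, SMOOTH because `Stab(v₀) ∩ (1 × G₁)` is open and lies in `ker χ`.  Then `τ(g, g₁) = χ(g₁) • τ(g, 1)`, the restriction
`σ := τ|_{G × 1}` is irreducible (same stable subspaces), smooth, and ADMISSIBLE (`V^{K′}(σ) ⊆ V^{K′ × (K₁ ∩ ker χ)}(τ)`, finite-dimensional), and the
identity of `V` is an isomorphism `σ ⊠ χ ≅ τ`: `⟦τ⟧ = IrrClass.boxChar χ hχ ⟦σ⟧`.  (The restriction-to-`G × 1` construction is that of ★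
`IrrClass.exists_eq_boxChar_of_isConstituentOf`, where the scalar action of `1 × G₁` came from a subquotient instead of from Schur.)

HONEST LABEL: HC_CM is proved only modulo the 7 printed citations (2 remaining named inputs: hLiu418 = stmt-HodgeConjecture-24832, h413 =
stmt-HodgeConjecture-24833) until rung 0 closes; this file is generic representation theory and discharges none of them.  REL ≠ ★ ≠ BUILT.

## References
* [BushnellHenniart2006] C. J. Bushnell, G. Henniart, *The Local Langlands Conjecture for GL(2)*, Grundlehren 335 (2006), §2.6 Corollary 1, §9.1.
* [Rogawski1990] J. D. Rogawski, *Automorphic Representations of Unitary Groups in Three Variables*, Ann. of Math. Stud. 123 (1990), §12.1 pp. 171–172.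
-/

set_option autoImplicit false
set_option linter.dupNamespace false

noncomputable section

open Literature.NumberTheory.Automorphic

namespace Summit.HodgeConjecture.HodgeConjecture.R90.S4

universe u

variable {G G₁ : Type u} [Group G] [TopologicalSpace G] [ContinuousMul G] [Group G₁] [TopologicalSpace G₁] [ContinuousMul G₁]

/-- **F1 «SCHUR ⊠-SPLITTING» — an admissible irreducible class of `G × G₁` (`G₁` commutative; `G`, `G₁` with compact open subgroups) is
`σ ⊠ χ` for an ADMISSIBLE class `σ` of `G` and a SMOOTH character `χ` of `G₁`** (the converse of ★ `IrrClass.boxChar`): `1 × G₁` is central, so it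
acts by scalars (Schur for admissible irreducibles, ★ `Representation.IsAdmissible.exists_eq_smul_id`), which form a smooth character `χ`; the
restriction to `G × 1` is irreducible, smooth, admissible, and boxes back to the class by the identity map.
[cite: BushnellHenniart2006, §2.6 Corollary 1; §9.1] [cite: Rogawski1990, §12.1 p. 172] -/
theorem exists_eq_boxChar_of_isAdmissible (hcomm : ∀ a b : G₁, a * b = b * a)
    {K : Subgroup G} (hKo : IsOpen (K : Set G)) (hKc : IsCompact (K : Set G))
    {K₁ : Subgroup G₁} (hK₁o : IsOpen (K₁ : Set G₁)) (hK₁c : IsCompact (K₁ : Set G₁))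
    {τ : IrrClass (G × G₁)} (hτ : τ.IsAdmissible) :
    ∃ (c : IrrClass G) (χ : G₁ →* ℂˣ) (hχ : IsOpen ((χ.ker : Subgroup G₁) : Set G₁)),
      c.IsAdmissible ∧ τ = IrrClass.boxChar χ hχ c := by
  obtain ⟨r, rfl⟩ := IrrClass.mk_surjective τ
  rw [IrrClass.isAdmissible_mk] at hτ
  -- a compact open subgroup of `G × G₁`
  have hKKo : IsOpen ((K.prod K₁ : Subgroup (G × G₁)) : Set (G × G₁)) := by
    rw [Subgroup.coe_prod]; exact hKo.prod hK₁o
  have hKKc : IsCompact ((K.prod K₁ : Subgroup (G × G₁)) : Set (G × G₁)) := by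
    rw [Subgroup.coe_prod]; exact hKc.prod hK₁c
  -- Schur: every central `(1, g₁)` acts by a scalar
  have hsc : ∀ g₁ : G₁, ∃ c : ℂ, r.ρ (1, g₁) = c • (LinearMap.id : r.V →ₗ[ℂ] r.V) := fun g₁ =>
    hτ.exists_eq_smul_id hKKo hKKc (r.ρ (1, g₁)) fun g => by
      rw [← Module.End.mul_eq_comp, ← Module.End.mul_eq_comp, ← map_mul, ← map_mul, Prod.mk_mul_mk, Prod.mk_mul_mk,
        one_mul, mul_one, hcomm g₁ g.2]
  choose c hc using hsc
  have hc' : ∀ (g₁ : G₁) (v : r.V), r.ρ (1, g₁) v = c g₁ • v := fun g₁ v => by rw [hc g₁]; rfl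
  haveI : Nontrivial r.V := Representation.IsIrreducible.nontrivial r.ρ
  obtain ⟨v₀, hv₀⟩ := exists_ne (0 : r.V)
  have huniq : ∀ {a b : ℂ}, a • v₀ = b • v₀ → a = b := fun {a b} h => by
    rw [← sub_eq_zero, ← sub_smul] at h
    exact sub_eq_zero.1 ((smul_eq_zero.1 h).resolve_right hv₀)
  -- the scalars form a character `χ : G₁ →* ℂˣ`
  let ω : G₁ →* ℂ :=
    { toFun := c
      map_one' := huniq <| by rw [← hc' 1, ← Prod.one_eq_mk, map_one, one_smul]; rfl
      map_mul' := fun a b => huniq <| by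
        rw [← hc' (a * b), show ((1 : G), a * b) = ((1 : G), a) * ((1 : G), b) by rw [Prod.mk_mul_mk, one_mul], map_mul,
          Module.End.mul_apply, hc' b, map_smul, hc' a, smul_smul, mul_comm] }
  let χ : G₁ →* ℂˣ := ω.toHomUnits
  have hχc : ∀ g₁ : G₁, ((χ g₁ : ℂˣ) : ℂ) = c g₁ := fun g₁ => rfl
  -- `χ` is smooth: `ker χ ⊇ {g₁ | (1, g₁) ∈ Stab(v₀)}`, an open subgroup
  have hχ : IsOpen ((χ.ker : Subgroup G₁) : Set G₁) := by
    refine Subgroup.isOpen_mono (H₁ := (r.ρ.stabilizerSubgroup v₀).comap (MonoidHom.inr G G₁)) ?_ ?_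
    · intro g₁ hg₁
      rw [Subgroup.mem_comap, Representation.mem_stabilizerSubgroup, MonoidHom.inr_apply, hc'] at hg₁
      rw [MonoidHom.mem_ker]
      refine Units.ext ?_
      rw [hχc, Units.val_one]
      exact huniq (by rw [hg₁, one_smul])
    · rw [Subgroup.coe_comap]
      exact (hτ.isSmooth v₀).preimage (continuous_const.prodMk continuous_id)
  -- `τ(g, g₁) = χ(g₁) • τ(g, 1)`
  have hdec : ∀ (g : G × G₁) (v : r.V), r.ρ g v = ((χ g.2 : ℂˣ) : ℂ) • r.ρ (g.1, 1) v := by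
    intro g v
    conv_lhs => rw [← Prod.fst_mul_snd g, map_mul, Module.End.mul_apply, hc', map_smul, ← hχc]
  -- the restriction `σ := τ|_{G × 1}`
  let s : SmoothIrrep G :=
    { V := r.V
      ρ := r.ρ.comp (MonoidHom.inl G G₁)
      isIrreducible :=
        (Representation.isIrreducible_iff_of_twist_equivariant r.ρ (r.ρ.comp (MonoidHom.inl G G₁)) (MonoidHom.fst G G₁)
          Prod.fst_surjective (LinearEquiv.refl ℂ r.V) (fun g => χ g.2) fun g v => hdec g v).1 r.isIrreducible
      isSmooth := r.isSmooth.comp (MonoidHom.inl G G₁) (continuous_id.prodMk continuous_const) }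
  have hs : ∀ (g : G) (v : r.V), s.ρ g v = r.ρ (g, 1) v := fun _ _ => rfl
  -- `σ` is admissible: `V^{K′}(σ) ⊆ V^{K′ × (K₁ ∩ ker χ)}(τ)`
  have hsadm : s.ρ.IsAdmissible := by
    refine ⟨s.isSmooth, fun K' hK'c => ?_⟩
    have h₁o : IsOpen ((K₁ ⊓ χ.ker : Subgroup G₁) : Set G₁) := by
      rw [Subgroup.coe_inf]; exact hK₁o.inter hχ
    have h₁c : IsCompact ((K₁ ⊓ χ.ker : Subgroup G₁) : Set G₁) :=
      hK₁c.of_isClosed_subset (Subgroup.isClosed_of_isOpen _ h₁o) fun g hg => hg.1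
    have hPo : IsOpen (((K' : Subgroup G).prod (K₁ ⊓ χ.ker) : Subgroup (G × G₁)) : Set (G × G₁)) := by
      rw [Subgroup.coe_prod]; exact K'.isOpen.prod h₁o
    have hPc : IsCompact (((K' : Subgroup G).prod (K₁ ⊓ χ.ker) : Subgroup (G × G₁)) : Set (G × G₁)) := by
      rw [Subgroup.coe_prod]; exact hK'c.prod h₁c
    haveI hfin := hτ.finite_fixedPoints ⟨(K' : Subgroup G).prod (K₁ ⊓ χ.ker), hPo⟩ hPc
    have hle : s.ρ.fixedPoints (K' : Subgroup G) ≤ r.ρ.fixedPoints ((K' : Subgroup G).prod (K₁ ⊓ χ.ker)) := by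
      intro v hv
      rw [Representation.mem_fixedPoints] at hv ⊢
      rintro ⟨g, g₁⟩ ⟨hg, hg₁⟩
      have hk : ((χ g₁ : ℂˣ) : ℂ) = 1 := by
        rw [(MonoidHom.mem_ker).1 (Subgroup.mem_inf.1 hg₁).2, Units.val_one]
      rw [hdec, hk, one_smul, ← hs]
      exact hv g hg
    exact Module.Finite.of_injective (Submodule.inclusion hle) (Submodule.inclusion_injective hle)
  refine ⟨IrrClass.mk s, χ, hχ, (IrrClass.isAdmissible_mk s).2 hsadm, ?_⟩
  -- `σ ⊠ χ ≅ τ` by the identity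
  rw [IrrClass.boxChar_mk]
  refine (IrrClass.mk_eq_mk_of_equiv
    (Representation.Equiv.mk (ρ := (s.boxChar χ hχ).ρ) (σ := r.ρ) (LinearEquiv.refl ℂ r.V) fun g => ?_)).symm
  refine LinearMap.ext fun v => ?_
  change (s.boxChar χ hχ).ρ g v = r.ρ g v
  rw [SmoothIrrep.boxChar_ρ_apply, hs, hdec g v]

end Summit.HodgeConjecture.HodgeConjecture.R90.S4

end
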